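import Literature.AnabelianGeometry.SemiGraphs.SgATemperedArrows
import HarnessLib

/-!
# [SemiAnbd] Rmk. 2.4.2 on the profinite presentation: the 2-cell of a 1-morphism as an EXPLICIT
# conjugating element, and its action on fibres (bridge brick L1d-conj, definition layer)

Mochizuki, *Semi-graphs of anabelioids*, Publ. RIMS **42** (2006), Rmk. 2.4.2 p. 26 (1-morphisms of
semi-graphs of anabelioids and their 2-cells `φ_b`), Def. 2.1 p. 23 ("`Π_b → Π_v` … well-defined up to
conjugation"), Def. 5.1 (iv) p. 63 ("compatible … up to composition with the inner action") (kurims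
`paper:url-f33ace170ff4`). [cite: MochizukiSemiAnbd2006, Rem. 2.4.2 p.26]

Brick of the (R1) bridge law L1 (HOME/staging/L3/L3-t3/R1-BRIDGE-SHAPES.md §4; interface owner
abc-iut-L3-t3), refining B2 `SgAToProfiniteHom.lean`: there, the square of the profinite reading of a
1-morphism `φ : 𝒢 → ℋ` along a branch commutes up to SOME inner automorphism
(`exists_conj_hVOfPath_brHomOfPath`).  The point-alignment input (PS3) of `CoveringGraphIsoOver.lean`
needs THE conjugator and what it does to points of fibres:

* `Aut.autMulEquivOfIso_pi1Map_eq_conj_of_iso` — the explicit form of B2's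
  `exists_conj_autMulEquivOfIso_pi1Map_of_iso` (conjugator `transportAut p (i ▹ F ≫ p')`);
* `HomOver.conjOfPaths φ b v h α𝒢 γv γe αℋ` — THE CONJUGATOR `k_b ∈ Π_{ℋ, f v}` of the square at the
  branch `b` for given paths: `π₁(φ_v) ∘ b_* = Inn(k_b) ∘ (f b)_* ∘ π₁(φ_e)`
  (`hVOfPath_brHomOfPath_eq_conj`);
* `HomOver.conjOfPaths_smul` — its ACTION ON FIBRES: `k_b · u = γ_v(α_𝒢(F_e(φ_b⁻¹)(γ_e⁻¹(α_ℋ⁻¹ u))))`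
  — transport back along the paths of `ℋ`, across the 2-cell `φ_b`, and forth along the paths of `𝒢`;
* `HomOver.castGe_hEAt` — re-indexing bookkeeping (`castGe` of `hEAt e (f e) rfl` is `hEAt e e' h`).

Definitions + bookkeeping only; nothing of the paper is asserted; no side taken on [IUTchIII] Cor. 3.12.
-/

noncomputable section

namespace Literature.AnabelianGeometry.SemiGraphs

open CategoryTheory CategoryTheory.Limits CategoryTheory.PreGaloisCategory
open Literature.AnabelianGeometry.Anabelioids
open SemiGraphOfAnabelioids (transportAut)

universe u

/-! ### Explicit conjugators for isomorphic pull-back functors -/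

section TransportLemmas

variable {X : Type u} [Category.{u} X] {Y : Type u} [Category.{u} Y]

/-- **Explicit form** of B2's `exists_conj_autMulEquivOfIso_pi1Map_of_iso`: for `i : Q ≅ Q'` and paths
`p : Q ⋙ F ≅ G`, `p' : Q' ⋙ F ≅ G`, with `g := transportAut p (i ▹ F ≫ p')`,
`p' ⋆ π₁(Q') σ = g (p ⋆ π₁(Q) σ) g⁻¹`. [cite: MochizukiGeoAn2004, Def. 1.1.2(ii) p.10] -/
theorem Aut.autMulEquivOfIso_pi1Map_eq_conj_of_iso {Q Q' : Y ⥤ X} (i : Q ≅ Q')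
    (F : X ⥤ FintypeCat.{u}) {G : Y ⥤ FintypeCat.{u}} (p : Q ⋙ F ≅ G) (p' : Q' ⋙ F ≅ G) (σ : Aut F) :
    Aut.autMulEquivOfIso p' (pi1Map Q' F σ) =
      transportAut p (Functor.isoWhiskerRight i F ≪≫ p') * Aut.autMulEquivOfIso p (pi1Map Q F σ) *
        (transportAut p (Functor.isoWhiskerRight i F ≪≫ p'))⁻¹ := by
  rw [pi1Map_of_iso i F σ, ← Aut.autMulEquivOfIso_apply_eq_conjAut,
    ← Aut.autMulEquivOfIso_eq_conj_of_paths p (Functor.isoWhiskerRight i F ≪≫ p'),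
    Aut.autMulEquivOfIso_apply_eq_conjAut, Aut.autMulEquivOfIso_apply_eq_conjAut,
    Aut.autMulEquivOfIso_apply_eq_conjAut, Iso.trans_conjAut]

/-- The action of (the inverse of) the explicit conjugator on fibres: `g⁻¹ · u = p(F(i⁻¹)(p'⁻¹ u))`.
[cite: MochizukiGeoAn2004, Def. 1.1.2(ii) p.10] -/
theorem transportAut_inv_smul {Q Q' : Y ⥤ X} (i : Q ≅ Q') (F : X ⥤ FintypeCat.{u})
    {G : Y ⥤ FintypeCat.{u}} (p : Q ⋙ F ≅ G) (p' : Q' ⋙ F ≅ G) (A : Y) (u : G.obj A) :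
    ((transportAut p (Functor.isoWhiskerRight i F ≪≫ p'))⁻¹ • u : G.obj A) =
      p.hom.app A (F.map (i.inv.app A) (p'.inv.app A u)) := by
  rw [mulAction_def, Aut.Aut_inv_def]
  rfl

end TransportLemmas

namespace SemiGraphOfAnabelioids

namespace HomOver

variable {𝒢 ℋ : SemiGraphOfAnabelioids.{u, u, u}} {f : 𝒢.graph ⟶ ℋ.graph} (φ : HomOver 𝒢 ℋ f)

/-! ### The conjugator of the square along a branch -/

/-- **The conjugator `k_b ∈ Π_{ℋ, f v}` of the square of `φ` along the branch `b` (abutting to `v`)**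
for paths `α_𝒢 : b^* ⋙ F_{𝒢,e} ≅ F_{𝒢,v}`, `γ_v : φ_v^* ⋙ F_{𝒢,v} ≅ F_{ℋ,f v}`,
`γ_e : φ_e^* ⋙ F_{𝒢,e} ≅ F_{ℋ,f e}`, `α_ℋ : (f b)^* ⋙ F_{ℋ,f e} ≅ F_{ℋ,f v}`: the inverse of the transport
element between the two paths `(φ_v^* ⋙ b^*) ⋙ F_{𝒢,e} ≅ F_{ℋ, f v}` obtained along `𝒢` and, across
the 2-cell `φ_b`, along `ℋ` (Rmk 2.4.2: the 2-cell read on fundamental groups).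
[cite: MochizukiSemiAnbd2006, Rem. 2.4.2 p.26] -/
def conjOfPaths (b : 𝒢.graph.Branch) (v : 𝒢.graph.Vertex) (h : 𝒢.graph.abuts b = some v)
    (α𝒢 : (𝒢.pull b v h).pullback ⋙ 𝒢.fibE (𝒢.graph.edgeOf b) ≅ 𝒢.fibV v)
    (γv : (φ.φV v).pullback ⋙ 𝒢.fibV v ≅ ℋ.fibV (f.vertexMap v))
    (γe : (φ.φE (𝒢.graph.edgeOf b) (ℋ.graph.edgeOf (f.branchMap b))
        (f.edgeOf_branchMap b).symm).pullback ⋙ 𝒢.fibE (𝒢.graph.edgeOf b) ≅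
        ℋ.fibE (ℋ.graph.edgeOf (f.branchMap b)))
    (αℋ : (ℋ.pull (f.branchMap b) (f.vertexMap v) (f.abuts_branchMap b v h)).pullback ⋙
        ℋ.fibE (ℋ.graph.edgeOf (f.branchMap b)) ≅ ℋ.fibV (f.vertexMap v)) :
    Aut (ℋ.fibV (f.vertexMap v)) :=
  (transportAut (G' := ((φ.φV v).pullback ⋙ (𝒢.pull b v h).pullback) ⋙ 𝒢.fibE (𝒢.graph.edgeOf b))
    (Functor.isoWhiskerLeft (φ.φV v).pullback α𝒢 ≪≫ γv)
    (Functor.isoWhiskerRight (φ.φB b v h) (𝒢.fibE (𝒢.graph.edgeOf b)) ≪≫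
      (Functor.isoWhiskerLeft
        (ℋ.pull (f.branchMap b) (f.vertexMap v) (f.abuts_branchMap b v h)).pullback γe ≪≫ αℋ)))⁻¹

/-- **The square along `b` commutes up to conjugation by `conjOfPaths`** (explicit form of B2's
`exists_conj_hVOfPath_brHomOfPath`): `π₁(φ_v)(b_* x) = k_b · (f b)_*(π₁(φ_e) x) · k_b⁻¹`.
[cite: MochizukiSemiAnbd2006, Rem. 2.4.2 p.26] -/
theorem hVOfPath_brHomOfPath_eq_conj (b : 𝒢.graph.Branch) (v : 𝒢.graph.Vertex)
    (h : 𝒢.graph.abuts b = some v)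
    (α𝒢 : (𝒢.pull b v h).pullback ⋙ 𝒢.fibE (𝒢.graph.edgeOf b) ≅ 𝒢.fibV v)
    (γv : (φ.φV v).pullback ⋙ 𝒢.fibV v ≅ ℋ.fibV (f.vertexMap v))
    (γe : (φ.φE (𝒢.graph.edgeOf b) (ℋ.graph.edgeOf (f.branchMap b))
        (f.edgeOf_branchMap b).symm).pullback ⋙ 𝒢.fibE (𝒢.graph.edgeOf b) ≅
        ℋ.fibE (ℋ.graph.edgeOf (f.branchMap b)))
    (αℋ : (ℋ.pull (f.branchMap b) (f.vertexMap v) (f.abuts_branchMap b v h)).pullback ⋙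
        ℋ.fibE (ℋ.graph.edgeOf (f.branchMap b)) ≅ ℋ.fibV (f.vertexMap v))
    (x : Aut (𝒢.fibE (𝒢.graph.edgeOf b))) :
    φ.hVOfPath v γv (𝒢.brHomOfPath b v h α𝒢 x) =
      φ.conjOfPaths b v h α𝒢 γv γe αℋ *
        ℋ.brHomOfPath (f.branchMap b) (f.vertexMap v) (f.abuts_branchMap b v h) αℋ
          (φ.hEOfPath (𝒢.graph.edgeOf b) (ℋ.graph.edgeOf (f.branchMap b))
            (f.edgeOf_branchMap b).symm γe x) *
        (φ.conjOfPaths b v h α𝒢 γv γe αℋ)⁻¹ := by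
  have hg : Aut.autMulEquivOfIso
        (X := ((ℋ.pull (f.branchMap b) (f.vertexMap v) (f.abuts_branchMap b v h)).pullback ⋙
          (φ.φE (𝒢.graph.edgeOf b) (ℋ.graph.edgeOf (f.branchMap b)) (f.edgeOf_branchMap b).symm).pullback) ⋙
            𝒢.fibE (𝒢.graph.edgeOf b))
        (Functor.isoWhiskerLeft
          (ℋ.pull (f.branchMap b) (f.vertexMap v) (f.abuts_branchMap b v h)).pullback γe ≪≫ αℋ)
        (pi1Map ((ℋ.pull (f.branchMap b) (f.vertexMap v) (f.abuts_branchMap b v h)).pullback ⋙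
          (φ.φE (𝒢.graph.edgeOf b) (ℋ.graph.edgeOf (f.branchMap b)) (f.edgeOf_branchMap b).symm).pullback)
          (𝒢.fibE (𝒢.graph.edgeOf b)) x) =
      (φ.conjOfPaths b v h α𝒢 γv γe αℋ)⁻¹ *
        Aut.autMulEquivOfIso (X := ((φ.φV v).pullback ⋙ (𝒢.pull b v h).pullback) ⋙ 𝒢.fibE _)
          (Functor.isoWhiskerLeft (φ.φV v).pullback α𝒢 ≪≫ γv)
          (pi1Map ((φ.φV v).pullback ⋙ (𝒢.pull b v h).pullback) (𝒢.fibE (𝒢.graph.edgeOf b)) x) *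
        φ.conjOfPaths b v h α𝒢 γv γe αℋ :=
    Aut.autMulEquivOfIso_pi1Map_eq_conj_of_iso (φ.φB b v h) (𝒢.fibE (𝒢.graph.edgeOf b))
      (Functor.isoWhiskerLeft (φ.φV v).pullback α𝒢 ≪≫ γv)
      (Functor.isoWhiskerLeft
        (ℋ.pull (f.branchMap b) (f.vertexMap v) (f.abuts_branchMap b v h)).pullback γe ≪≫ αℋ) x
  rw [hVOfPath_apply, SemiGraphOfAnabelioids.brHomOfPath_apply,
    SemiGraphOfAnabelioids.brHomOfPath_apply, hEOfPath_apply,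
    Aut.autMulEquivOfIso_pi1Map_autMulEquivOfIso_pi1Map,
    Aut.autMulEquivOfIso_pi1Map_autMulEquivOfIso_pi1Map, hg]
  group

/-- **The conjugator on points of fibres**: `k_b · u = γ_v(α_𝒢(F_{𝒢,e}(φ_b⁻¹)(γ_e⁻¹(α_ℋ⁻¹(u)))))` for
`u ∈ F_{ℋ,f v}(X)` — back along the paths of `ℋ` to `F_{𝒢,e}(φ_e^*((f b)^* X))`, across the 2-cell
`φ_b⁻¹` to `F_{𝒢,e}(b^*(φ_v^* X))`, forth along the paths of `𝒢`. [cite: MochizukiSemiAnbd2006, Rem. 2.4.2 p.26] -/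
theorem conjOfPaths_smul (b : 𝒢.graph.Branch) (v : 𝒢.graph.Vertex) (h : 𝒢.graph.abuts b = some v)
    (α𝒢 : (𝒢.pull b v h).pullback ⋙ 𝒢.fibE (𝒢.graph.edgeOf b) ≅ 𝒢.fibV v)
    (γv : (φ.φV v).pullback ⋙ 𝒢.fibV v ≅ ℋ.fibV (f.vertexMap v))
    (γe : (φ.φE (𝒢.graph.edgeOf b) (ℋ.graph.edgeOf (f.branchMap b))
        (f.edgeOf_branchMap b).symm).pullback ⋙ 𝒢.fibE (𝒢.graph.edgeOf b) ≅
        ℋ.fibE (ℋ.graph.edgeOf (f.branchMap b)))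
    (αℋ : (ℋ.pull (f.branchMap b) (f.vertexMap v) (f.abuts_branchMap b v h)).pullback ⋙
        ℋ.fibE (ℋ.graph.edgeOf (f.branchMap b)) ≅ ℋ.fibV (f.vertexMap v))
    (X : ℋ.V (f.vertexMap v)) (u : (ℋ.fibV (f.vertexMap v)).obj X) :
    (φ.conjOfPaths b v h α𝒢 γv γe αℋ • u : (ℋ.fibV (f.vertexMap v)).obj X) =
      γv.hom.app X (α𝒢.hom.app ((φ.φV v).pullback.obj X)
        ((𝒢.fibE (𝒢.graph.edgeOf b)).map ((φ.φB b v h).inv.app X)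
          (γe.inv.app ((ℋ.pull (f.branchMap b) (f.vertexMap v) (f.abuts_branchMap b v h)).pullback.obj X)
            (αℋ.inv.app X u)))) :=
  transportAut_inv_smul (φ.φB b v h) (𝒢.fibE (𝒢.graph.edgeOf b))
    (Functor.isoWhiskerLeft (φ.φV v).pullback α𝒢 ≪≫ γv)
    (Functor.isoWhiskerLeft
      (ℋ.pull (f.branchMap b) (f.vertexMap v) (f.abuts_branchMap b v h)).pullback γe ≪≫ αℋ) X u

/-! ### Re-indexing bookkeeping -/

/-- `castGe` of the edge homomorphism at the canonical presentation `(e, f e, rfl)` is the edge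
homomorphism at the presentation `(e, e', h)`. [cite: MochizukiSemiAnbd2006, Rem. 2.4.2 p.26] -/
theorem castGe_hEAt (e : 𝒢.graph.Edge) {e' : ℋ.graph.Edge} (h : f.edgeMap e = e')
    (x : Aut (𝒢.fibE e)) :
    ℋ.toProfinite.castGe h (φ.hEAt e (f.edgeMap e) rfl x) = φ.hEAt e e' h x := by
  subst h; rfl

end HomOver

end SemiGraphOfAnabelioids

end Literature.AnabelianGeometry.SemiGraphs

end
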